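import Summits.QuantumFields.BalabanUV.T4Continuum.Support.NE7ApeFlatSkeletonLocal
import HarnessLib

/-!
# NE7ApeOfTorusRoadLetters — THE END OF THE TORUS ROAD IN KERNEL (memo §7, step (N5) assembled): `hape` (= [Balaban1985Variational] Prop. 8) ⇐ PER PLAQUETTE,
# the FLAT letters of F245 at some flat reference `F̃` (a local chart `A` with a gauge `u` matching `U^u` to `F̃e^{A}` on the plaquette, the hess-orthogonal exact
# normal part `A_N`, the slice solver `K_G`, the expansion density `ρ`, the criticality DEFECT `τ`) whose total `K_G(τ+ρ) + ‖d_{F̃}A_N(p)‖ + 28α₀²` is AFFINE-SMALL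
# `(c₀ + θ·r)∕M²` in the radius `r` — then the affine iteration (F243) gives the gain

Cell `pub-balaban`, rung (B)+1 sub-cell t4, lineage `b2b-balaban-t4-ne7-p1` (CRUX PROVER NE7 #1 = OWNER of row NE7), generation 88; memo
`t4/b2b-balaban-t4-ne7-p1-g88/EXISTENCE-BY-INDUCTION.md` §7.  File F246 (over F245 `NE7ApeFlatSkeletonLocal.norm_plaq_sub_one_le_of_flatLetters_local_gauge`, F243
`NE7ApeOfLocalChartLetter.smallField_floor_of_affineImprovement`).

WHY.  F243 displayed ONE opaque per-plaquette letter `hloc` (a chart with a curl bound); F245 decomposed the curl bound into Sect. F's flat letters at a flat reference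
with a criticality DEFECT and a POINTWISE normal curl.  THIS FILE is the END in F245's vocabulary: the suppliers of the torus road — (N1) the local Landau chart `A` (with
the cutoff already applied: `A` here is the GLOBAL field `χ·A_loc`), (N2) the cutoff commutators and the paired Euler–Lagrange term (inside `τ`), the flat expansion
remainder (inside `ρ`), the flat lift `A_N = H♭Q(A)` with (R⊥♭) (`hNorth`, OWNED at `F̃ = 1`: F40b) and (N3) its decaying curl row READ AT THE PLAQUETTE (inside the numeric
line), G♭ (`hG`, OWNED: p393256), (N4) the local datum bound (inside `c₀`) — each deliver a named component of the bundle `hltr`, and the numeric line `K_G(τ + ρ) +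
‖curlAt F̃ A_N z μ ν‖ + 28α₀² ≤ (c₀ + θr)∕M²` is where their currencies meet (`K_G = K·M`, `τ + ρ ≲ (quadratic + R⁻¹)·r∕M³`, `‖d A_N(p)‖ ≲ (C_Hβ + R^d e^{−R∕2c}r)∕M²`,
`α₀ ≲ Rr∕M`).
WHAT ([folklore] composition; 0 def, 0 sorry).
§1 **`hape_of_torusRoadLetters`** — for `c₀ ≥ 0`, `0 ≤ θ < 1`, `c₀ + θδ ≤ δ`: the per-plaquette bundle `hltr` (for every datum of `𝒟_β`, level `k+1`, admissible
   tangent-critical `U` with `SmallField U (r∕M²)`, `0 ≤ r ≤ δ`, corner `z`, plane `μ ≠ ν`: `∃ F̃ x A A_N S K_G ρ τ α₀ u` with F245 §2's letters on the torus of period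
   `N·L^{k+1}` and the numeric line) ⟹ F31's `hape` for every `δ₁ > c₀∕(1 − θ)`.
HONEST FRAMING (page 1): composition over HYPOTHESES; the bundle `hltr` is asserted for nothing — its components (N1)–(N4) are NOT in the tree (G♭, H♭, (R⊥♭), flat EXP,
`rightInvW`, F244 are); nothing of Bałaban's asserted; NOT (APE), NOT ONE-STEP, NOT NE7; spine 0∕9; finite T⁴ rung (B)+1 — NOT infinite volume, NOT mass gap, NOT
`BetaPertH`, NOT Clay.  Continuum YM on T⁴ ⇐ BetaPertH ∧ nine spine estimates (0/9 proved); BetaPertH ⇐ (D1) ∧ (D4) ∧ CAP+tail; G-an2-4 gates asym, D1 and NE2/3/4.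
-/

set_option autoImplicit false

open scoped BigOperators Matrix.Norms.L2Operator
open NormedSpace Finset Set

namespace Summit.QuantumFields.BalabanUV.T4Continuum.NE7ApeOfTorusRoadLetters

open Literature.MathematicalPhysics.QuantumFieldTheory.Balaban1983to89
open B7Prop1Explicit B7Prop2Explicit MatrixLog UnitaryModel
open T4AveragingDeficitWall (IsUnitaryCfg IsSkewDir SmallField vary curlAt dirL1)
open T4AveragingDeficitWallBoundary (IsPeriodicCfg periodBox)
open AveragingDeficitPeriodicCounting (IsPeriodicDir)
open AveragingDeficitMultiLevelPrep (LevelSmall TangentIter)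
open MinimalActionLevels (perWin)
open MinimalActionSandwich (admissible)
open MinimalActionRate (sfClass)
open NE3HessForm (hess dAction)
open NE3TangentCovariantTower (dirIter)
open NE3EnergyShapes (IsUnitarySite)
open NE7ApeFlatSkeletonLocal (norm_plaq_sub_one_le_of_flatLetters_local_gauge)
open NE7ApeOfLocalChartLetter (smallField_floor_of_affineImprovement)

noncomputable section

variable {d : ℕ} {n : Type*} [Fintype n] [DecidableEq n]

/-! ## §1 THE END of the torus road: `hape` from the per-plaquette flat letter bundle -/

/-- **`hape` ⇐ THE PER-PLAQUETTE FLAT LETTER BUNDLE OF THE TORUS ROAD** (statement in the module docstring §1; the bundle's components are literally the hypotheses of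
F245 `norm_plaq_sub_one_le_of_flatLetters_local_gauge` on the torus of period `P = N·L^{k+1}`, plus the numeric line where the suppliers' currencies meet).
[cite: Balaban1985Variational, Prop. 8 p.304] -/
theorem hape_of_torusRoadLetters [Nonempty n] {L N : ℕ} (hL : 1 ≤ L) {ε δ δ₁ β c₀ θ : ℝ} (hc₀ : 0 ≤ c₀) (hθ0 : 0 ≤ θ) (hθ1 : θ < 1)
    (hcδ : c₀ + θ * δ ≤ δ) (hδ₁ : c₀ / (1 - θ) < δ₁)
    (hltr : ∀ D : Site d → Fin d → (Matrix n n ℂ)ˣ, IsUnitaryCfg D → IsPeriodicCfg D (N : ℤ) → SmallField D (4 * (Real.exp β - 1)) →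
      ∀ (k : ℕ), ∀ U ∈ admissible (sfClass d L N ε) L (k + 1) D,
      (∀ φ : Site d → Fin d → Matrix n n ℂ, IsSkewDir φ → IsPeriodicDir φ ((N * L ^ (k + 1) : ℕ) : ℤ) → TangentIter L k U φ →
        dAction U φ (perWin d (N * L ^ (k + 1))) = 0) →
      ∀ r : ℝ, 0 ≤ r → r ≤ δ → SmallField U (r / ((L : ℝ) ^ (k + 1)) ^ 2) →
      ∀ (z : Site d) (μ ν : Fin d), μ ≠ ν →
        ∃ (Ft : Site d → Fin d → (Matrix n n ℂ)ˣ) (x : ℝ) (A AN : Site d → Fin d → Matrix n n ℂ) (S : Set (Site d → Fin d → Matrix n n ℂ))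
          (KG ρ τ α₀ : ℝ) (u : Site d → (Matrix n n ℂ)ˣ),
          -- the flat reference
          (IsUnitaryCfg Ft ∧ SmallField Ft 0 ∧ 0 ≤ x ∧ LevelSmall d L k x ∧ SmallField Ft x) ∧
          -- the chart (N1, cut off)
          (IsSkewDir A ∧ IsPeriodicDir A ((N * L ^ (k + 1) : ℕ) : ℤ) ∧ (∀ y κ, ‖A y κ‖ ≤ α₀)) ∧
          -- the normal part: exact, hess-orthogonal (H♭, (R⊥♭))
          (IsSkewDir AN ∧ IsPeriodicDir AN ((N * L ^ (k + 1) : ℕ) : ℤ) ∧ dirIter L (k + 1) Ft AN = dirIter L (k + 1) Ft A ∧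
            (∀ Y : Site d → Fin d → Matrix n n ℂ, IsSkewDir Y → IsPeriodicDir Y ((N * L ^ (k + 1) : ℕ) : ℤ) → dirIter L (k + 1) Ft Y = 0 →
              hess Ft AN Y (perWin d (N * L ^ (k + 1))) = 0)) ∧
          -- the slice and the slice solver (G♭)
          ((fun y κ => A y κ - AN y κ) ∈ S ∧
            (∀ X ∈ S, IsSkewDir X → IsPeriodicDir X ((N * L ^ (k + 1) : ℕ) : ℤ) → dirIter L (k + 1) Ft X = 0 → ∀ g : ℝ, 0 ≤ g →
              (∀ Y : Site d → Fin d → Matrix n n ℂ, IsSkewDir Y → IsPeriodicDir Y ((N * L ^ (k + 1) : ℕ) : ℤ) → dirIter L (k + 1) Ft Y = 0 →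
                |hess Ft X Y (perWin d (N * L ^ (k + 1)))| ≤ g * dirL1 Y (periodBox (d := d) (N * L ^ (k + 1)))) →
              ∀ z' μ' ν', μ' ≠ ν' → ‖curlAt Ft X z' μ' ν'‖ ≤ KG * g)) ∧
          -- the flat expansion remainder
          (0 ≤ ρ ∧ (∀ Y : Site d → Fin d → Matrix n n ℂ, IsSkewDir Y → IsPeriodicDir Y ((N * L ^ (k + 1) : ℕ) : ℤ) →
            |dAction (vary Ft A 1) Y (perWin d (N * L ^ (k + 1))) - hess Ft A Y (perWin d (N * L ^ (k + 1)))|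
              ≤ ρ * dirL1 Y (periodBox (d := d) (N * L ^ (k + 1))))) ∧
          -- the criticality defect (N2 + the paired Euler–Lagrange term)
          (0 ≤ τ ∧ (∀ Y : Site d → Fin d → Matrix n n ℂ, IsSkewDir Y → IsPeriodicDir Y ((N * L ^ (k + 1) : ℕ) : ℤ) → dirIter L (k + 1) Ft Y = 0 →
            |dAction (vary Ft A 1) Y (perWin d (N * L ^ (k + 1)))| ≤ τ * dirL1 Y (periodBox (d := d) (N * L ^ (k + 1))))) ∧
          -- the gauge matching `U` to the representative on the plaquette
          (IsUnitarySite u ∧ gaugeAct u U z μ = vary Ft A 1 z μ ∧ gaugeAct u U (z + e μ) ν = vary Ft A 1 (z + e μ) ν ∧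
            gaugeAct u U (z + e ν) μ = vary Ft A 1 (z + e ν) μ ∧ gaugeAct u U z ν = vary Ft A 1 z ν) ∧
          -- the numeric line where the currencies meet (N3's decayed normal curl at the plaquette, N4's datum bound inside `c₀`)
          KG * (τ + ρ) + ‖curlAt Ft AN z μ ν‖ + 28 * α₀ ^ 2 ≤ (c₀ + θ * r) / ((L : ℝ) ^ (k + 1)) ^ 2) :
    ∀ D : Site d → Fin d → (Matrix n n ℂ)ˣ, IsUnitaryCfg D → IsPeriodicCfg D (N : ℤ) → SmallField D (4 * (Real.exp β - 1)) →
      ∀ (k : ℕ), ∀ U ∈ admissible (sfClass d L N ε) L (k + 1) D, SmallField U (δ / ((L : ℝ) ^ (k + 1)) ^ 2) →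
      (∀ φ : Site d → Fin d → Matrix n n ℂ, IsSkewDir φ → IsPeriodicDir φ ((N * L ^ (k + 1) : ℕ) : ℤ) → TangentIter L k U φ →
        dAction U φ (perWin d (N * L ^ (k + 1))) = 0) → SmallField U (δ₁ / ((L : ℝ) ^ (k + 1)) ^ 2) := by
  intro D hDu hDP hDs k U hU hUδ hcrit
  have hLpos : (0 : ℝ) < L := by exact_mod_cast (by omega : 0 < L)
  set M2 : ℝ := ((L : ℝ) ^ (k + 1)) ^ 2 with hM2
  have hS : 0 < M2 := by positivity
  -- the affine improvement at this configuration, plaquette by plaquette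
  have himp : ∀ r : ℝ, 0 ≤ r → r ≤ δ → SmallField U (r / M2) → SmallField U ((c₀ + θ * r) / M2) := by
    intro r hr0 hrδ hUr z μ ν hμν
    obtain ⟨Ft, x, A, AN, S, KG, ρ, τ, α₀, u, ⟨hFt, hFt0, hx, hs, hFtx⟩, ⟨hA, hAP, hAα⟩, ⟨hNs, hNP, hNexact, hNorth⟩, ⟨hTS, hG⟩, ⟨hρ, hEXP⟩,
      ⟨hτ, hcritD⟩, ⟨hu, h1, h2, h3, h4⟩, hnum⟩ := hltr D hDu hDP hDs k U hU hcrit r hr0 hrδ hUr z μ ν hμν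
    exact (norm_plaq_sub_one_le_of_flatLetters_local_gauge hL k hFt hFt0 hx hs hFtx hA hAP hAα hNs hNP hNexact hNorth S hTS hG hρ hEXP hτ hcritD hu z
      hμν h1 h2 h3 h4).trans hnum
  exact smallField_floor_of_affineImprovement hS hc₀ hθ0 hθ1 hcδ hδ₁ himp hUδ

end

end Summit.QuantumFields.BalabanUV.T4Continuum.NE7ApeOfTorusRoadLetters
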